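import Summits.Ventures.CertifiedManyBodySolver.Observables.ThermalFluxZeeman
import Summits.HubbardSuperconductivity.HubbardSuperconductivity.Theorems.WidthHaldaneTubeSectorPartitionBlock
import HarnessLib

/-!
# Ventures/CertifiedManyBodySolver — Observables/ThermalFluxZeemanOperator.lean

HONEST FRAMING: bookkeeping only — the OPERATOR reading of the sector-sum definition `zeemanFluxZ` of `ThermalFluxZeeman`: it IS the
canonical partition function of the flux-twisted one-band `t–t′–U` torus with the Zeeman term, `Tr_{N_L} e^{−β(H(θ) − h S^z)}`. No new
number, no new ceiling; a ceiling never speaks to the presence of order.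

Cell `hubbard-tc` (MO-S3; `T × P × H`, D-0099), seat p1, `prover-hubbard-tc-p1-g5-0`. PROVED here (standard axioms, no definition, no
named fact): `zeemanFluxZ_eq_re_partitionFn` —
`zeemanFluxZ L tp U δ β h θ = Re Z_β((hubbardTorusTT'Flux L tp U θ − h·S^z)|_{N_L})`, `S^z = HubbardWave0.spinZ = ½Σ_x(n_{x↑} − n_{x↓})`,
`N_L = 2⌊(1−δ)L²/2⌋`, the compression to the `N_L`-electron coordinate sector. Ingredients: `H(θ)` conserves `N↑, N↓`
(`preservesSectors_hubbardTorusTT'Flux`) and `S^z` is diagonal (`LiebThm1.spinZ_eq_diagonal`), so `H(θ) − hS^z` has no entries between an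
`(N, N↑ = M)` block and its complement; the Gibbs weight of such a matrix compresses block by block (`WidthHaldane.toBlock_gibbsWeight_of_toBlock_compl_eq_zero`);
on the `(N_L, M)` block `S^z = (M − N_L/2)·1`, and a scalar shift multiplies `Z` by `e^{βh(M − N_L/2)}` (`partitionFn_add_smul_one`); the
`N_L`-sector trace is the sum of the `(N_L, M)`-sector traces, `M = 0, …, N_L`.

References: D. J. Scalapino, S. R. White, S. Zhang, PRB 47 (1993) 7995, §II [ScalapinoWhiteZhang1993]; E. H. Lieb, PRL 62 (1989) 1201,
eq. (2) [LiebPRL1989].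
-/

noncomputable section

namespace Summit.Ventures.CertifiedManyBodySolver.Observables

open Real Matrix Finset
open Literature.MathematicalPhysics.QuantumLattice
open Literature.MathematicalPhysics.QuantumFieldTheory
open Literature.Probability.LatticeModels
open Summit.HubbardSuperconductivity.HubbardSuperconductivity.Theorems.WidthHaldane
open scoped ComplexConjugate ComplexOrder

variable {L : ℕ} [NeZero L]

/-- The number of spin-`0` orbitals of a configuration is the number of its up electrons — a verbatim restatement of pub-hubbard's
`Summit.HubbardSuperconductivity.HubbardLadder.Bounds.card_filter_spin_zero_eq_card_upPart` (`Bounds/ThermalMottStiffnessCeiling.lean`),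
repeated here only to avoid importing the Mott-window ceiling module for one counting lemma. [cite: LiebPRL1989, eq. (2)] -/
theorem card_filter_spin_zero_eq_card_upPart' {Λ : Type*} [LinearOrder Λ] [Fintype Λ]
    (s : Finset (Orb Λ)) : (s.filter fun i => (ofLex i).2 = 0).card = (upPart s).card := by
  rw [show (s.filter fun i => (ofLex i).2 = 0) = (upPart s).image (fun x => orb x 0) from ?_,
    Finset.card_image_of_injective _ (fun x y h => (orb_inj.1 h).1)]
  ext i
  simp only [Finset.mem_filter, Finset.mem_image, mem_upPart]
  constructor
  · rintro ⟨hi, h0⟩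
    refine ⟨(ofLex i).1, ?_, ?_⟩ <;>
    · have : orb (ofLex i).1 0 = i := by rw [← h0]; exact toLex_ofLex i
      simp [this, hi]
  · rintro ⟨x, hx, rfl⟩
    exact ⟨hx, rfl⟩

/-- **The Zeeman Hamiltonian `H(θ) − h·S^z` has no entries from an `(N, N↑ = M)` coordinate block to its complement** (`H(θ)` conserves
`N↑, N↓`; `S^z` is diagonal). [cite: LiebPRL1989, eq. (2)] -/
theorem zeemanHamiltonian_toBlock_compl_eq_zero (tp U θ h : ℝ) (p : Finset (Orb (FermionTorus 2 L)) → Prop) [DecidablePred p]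
    (hp : ∀ s t : Finset (Orb (FermionTorus 2 L)), (upPart s).card = (upPart t).card → (downPart s).card = (downPart t).card →
      (p s ↔ p t)) :
    (hubbardTorusTT'Flux L tp U θ - (h : ℂ) • (HubbardWave0.spinZ : Matrix _ _ ℂ)).toBlock p (fun a => ¬ p a) = 0 := by
  ext a b
  have hab : (a : Finset (Orb (FermionTorus 2 L))) ≠ b := fun e => b.2 (by rw [← e]; exact a.2)
  have hz : (HubbardWave0.spinZ : Matrix _ _ ℂ) (a : Finset (Orb (FermionTorus 2 L))) b = 0 := by
    rw [congrFun (congrFun (LiebThm1.spinZ_eq_diagonal (Λ := FermionTorus 2 L)) a) b]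
    simp only [diagonal, of_apply]
    rw [if_neg hab]
  rw [toBlock_apply, Matrix.zero_apply, Matrix.sub_apply, Matrix.smul_apply, hz, smul_zero, sub_zero]
  by_contra hne
  have hs := preservesSectors_hubbardTorusTT'Flux L tp U θ a.1 b.1 hne
  exact b.2 ((hp _ _ hs.1 hs.2).1 a.2)

/-- On a coordinate block inside `(N↑, N↓) = (M, N − M)` the Zeeman Hamiltonian is the scalar shift `H(θ)|_p + (−h(M − N/2))·1`.
[cite: LiebPRL1989, eq. (2)] -/
theorem zeemanHamiltonian_toBlock_eq (tp U θ h : ℝ) (N M : ℕ) (p : Finset (Orb (FermionTorus 2 L)) → Prop) [DecidablePred p]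
    (hpM : ∀ s, p s → (upPart s).card = M ∧ (downPart s).card + M = N) :
    (hubbardTorusTT'Flux L tp U θ - (h : ℂ) • (HubbardWave0.spinZ : Matrix _ _ ℂ)).toBlock p p =
      (hubbardTorusTT'Flux L tp U θ).toBlock p p + ((-(h * ((M : ℝ) - (N : ℝ) / 2)) : ℝ) : ℂ) • 1 := by
  ext a b
  have hz : (HubbardWave0.spinZ : Matrix _ _ ℂ) (a : Finset (Orb (FermionTorus 2 L))) b =
      if (a : Finset (Orb (FermionTorus 2 L))) = b then
        (1 / 2 : ℂ) * (((upPart (a : Finset (Orb (FermionTorus 2 L)))).card : ℂ) -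
          ((downPart (a : Finset (Orb (FermionTorus 2 L)))).card : ℂ)) else 0 := by
    rw [congrFun (congrFun (LiebThm1.spinZ_eq_diagonal (Λ := FermionTorus 2 L)) a) b]
    simp only [diagonal, of_apply]
  simp only [toBlock_apply, Matrix.sub_apply, Matrix.add_apply, Matrix.smul_apply, Matrix.one_apply, hz, smul_eq_mul]
  by_cases hab : a = b
  · subst hab
    obtain ⟨hu, hd⟩ := hpM _ a.2
    rw [if_pos rfl, if_pos rfl, hu]
    have hdn : ((downPart (a : Finset (Orb (FermionTorus 2 L)))).card : ℂ) = (N : ℂ) - (M : ℂ) := by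
      have : (((downPart (a : Finset (Orb (FermionTorus 2 L)))).card + M : ℕ) : ℂ) = (N : ℂ) := by exact_mod_cast hd
      push_cast at this
      linear_combination this
    rw [hdn]
    push_cast
    ring
  · have hab' : (a : Finset (Orb (FermionTorus 2 L))) ≠ b := fun e => hab (Subtype.ext e)
    rw [if_neg hab', if_neg hab, mul_zero, mul_zero, sub_zero, add_zero]

/-- The partition function of a compression of a block-respecting matrix is the sum of the diagonal Gibbs-weight entries over the block.
[folklore] -/
theorem partitionFn_toBlock_eq_sum_diag {ι : Type*} [Fintype ι] [DecidableEq ι] (β : ℝ) (K : Matrix ι ι ℂ) (p : ι → Prop)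
    [DecidablePred p] (hK : K.toBlock p (fun a => ¬ p a) = 0) :
    partitionFn β (K.toBlock p p) = ∑ a ∈ Finset.univ.filter p, gibbsWeight β K a a := by
  rw [partitionFn, ← toBlock_gibbsWeight_of_toBlock_compl_eq_zero β K p hK, Matrix.trace]
  simp only [Matrix.diag, toBlock_apply]
  rw [Finset.sum_subtype (Finset.univ.filter p) (fun x => by simp : ∀ x, x ∈ Finset.univ.filter p ↔ p x)
    (fun a => gibbsWeight β K a a)]

/-- **The sector-sum definition is the operator partition function**:
`zeemanFluxZ L tp U δ β h θ = Re Z_β((H(θ) − h·S^z)|_{N_L})` with `H(θ) = hubbardTorusTT'Flux L tp U θ`, `S^z = HubbardWave0.spinZ`,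
`N_L = 2⌊(1−δ)L²/2⌋` (compression to the `N_L`-electron coordinate sector). [cite: ScalapinoWhiteZhang1993, §II] -/
theorem zeemanFluxZ_eq_re_partitionFn (tp U δ β h θ : ℝ) :
    zeemanFluxZ L tp U δ β h θ =
      (partitionFn β ((hubbardTorusTT'Flux L tp U θ - (h : ℂ) • (HubbardWave0.spinZ : Matrix _ _ ℂ)).toBlock
        (fun s : Finset (Orb (FermionTorus 2 L)) => s.card = 2 * ⌊(1 - δ) * (L : ℝ) ^ 2 / 2⌋₊)
        (fun s : Finset (Orb (FermionTorus 2 L)) => s.card = 2 * ⌊(1 - δ) * (L : ℝ) ^ 2 / 2⌋₊))).re := by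
  set n := ⌊(1 - δ) * (L : ℝ) ^ 2 / 2⌋₊ with hn
  set K := hubbardTorusTT'Flux L tp U θ - (h : ℂ) • (HubbardWave0.spinZ : Matrix _ _ ℂ) with hKdef
  -- the N-sector and the (N, M)-sectors are respected by K
  have hN : K.toBlock (fun s : Finset (Orb (FermionTorus 2 L)) => s.card = 2 * n)
      (fun s => ¬ s.card = 2 * n) = 0 :=
    zeemanHamiltonian_toBlock_compl_eq_zero tp U θ h _ fun s t hu hd => by
      rw [card_eq_upPart_add_downPart s, card_eq_upPart_add_downPart t, hu, hd]
  have hNM : ∀ M : ℕ, K.toBlock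
      (fun s : Finset (Orb (FermionTorus 2 L)) => s.card = 2 * n ∧ (s.filter fun i => (ofLex i).2 = 0).card = M)
      (fun s => ¬ (s.card = 2 * n ∧ (s.filter fun i => (ofLex i).2 = 0).card = M)) = 0 := fun M =>
    zeemanHamiltonian_toBlock_compl_eq_zero tp U θ h _ fun s t hu hd => by
      rw [card_eq_upPart_add_downPart s, card_eq_upPart_add_downPart t, card_filter_spin_zero_eq_card_upPart',
        card_filter_spin_zero_eq_card_upPart', hu, hd]
  -- the N-sector partition function as a sum of diagonal entries, regrouped by the number of up electrons
  have hZN := partitionFn_toBlock_eq_sum_diag β K _ hN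
  have hmaps : ∀ s ∈ Finset.univ.filter (fun s : Finset (Orb (FermionTorus 2 L)) => s.card = 2 * n),
      (s.filter fun i => (ofLex i).2 = 0).card ∈ Finset.range (2 * n + 1) := by
    intro s hs
    rw [Finset.mem_filter] at hs
    rw [Finset.mem_range]
    have := Finset.card_filter_le s (fun i => (ofLex i).2 = 0)
    omega
  rw [← Finset.sum_fiberwise_of_maps_to hmaps] at hZN
  -- each fibre is an (N, M)-sector partition function with the Zeeman weight
  have hfib : ∀ M ∈ Finset.range (2 * n + 1),
      ∑ s ∈ (Finset.univ.filter (fun s : Finset (Orb (FermionTorus 2 L)) => s.card = 2 * n)).filter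
          (fun s => (s.filter fun i => (ofLex i).2 = 0).card = M), gibbsWeight β K s s =
        (Real.exp (β * h * ((M : ℝ) - n)) : ℂ) *
          partitionFn β ((hubbardTorusTT'Flux L tp U θ).toBlock
            (fun s : Finset (Orb (FermionTorus 2 L)) => s.card = 2 * n ∧ (s.filter fun i => (ofLex i).2 = 0).card = M)
            (fun s : Finset (Orb (FermionTorus 2 L)) => s.card = 2 * n ∧ (s.filter fun i => (ofLex i).2 = 0).card = M)) := by
    intro M _
    rw [Finset.filter_filter, ← partitionFn_toBlock_eq_sum_diag β K _ (hNM M),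
      zeemanHamiltonian_toBlock_eq tp U θ h (2 * n) M _ (fun s hs => ?_), partitionFn_add_smul_one]
    · congr 1
      push_cast
      ring_nf
    · obtain ⟨hc, hf⟩ := hs
      rw [card_filter_spin_zero_eq_card_upPart'] at hf
      refine ⟨hf, ?_⟩
      have := card_eq_upPart_add_downPart s
      omega
  rw [Finset.sum_congr rfl hfib] at hZN
  rw [hZN, Complex.re_sum]
  unfold zeemanFluxZ
  refine Finset.sum_congr rfl fun M _ => ?_
  rw [Complex.re_ofReal_mul]

end Summit.Ventures.CertifiedManyBodySolver.Observables

end
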